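import Mathlib
import HarnessLib
import Summits.HubbardSuperconductivity.HubbardSuperconductivity.Theorems.KLProgrammeKLRegimeEngineGeneralStepAliasArithGraded
import Summits.HubbardSuperconductivity.HubbardSuperconductivity.Theorems.KLProgrammeKLRegimeEngineLastStepAliasRowsGradedS
import Summits.HubbardSuperconductivity.HubbardSuperconductivity.Theorems.KLProgrammeKLRegimeEngineFrameShiftReadingPointDoors

/-!
# K3 gen-8-FLOW (stmt 20437, stub (C), the (B) door's ARITHMETIC WORD at the general step): the right-hand side of the general-step (B) door
# `…_main_add_alias_pos` against the (B)-FIT budget `μc_l·U²·4^{(l−2)(m+1)}` — abstract real arithmetic (cell gate-hubbard-kl, seat p2 g22)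

The general-step (B) door of record in position currency, `…FrameShiftDressingSupFlowMainAliasPos.…_main_add_alias_pos` (p648976), bounds the order-`l`
momentum jet of the frame-RESPONSE symbol at a reading point below both shells by
`MAIN(fd, Np) + (2^29·4^m·Nj² + 2^12 + 2^23·Nj′)·(√Rsq⁸·U³⁰/(2^218·β^14)) + (2^26·4^m·Ns² + 2^9 + 2^20·Ns′)·Xv⁴`,
`MAIN = 2·(2·(|β|L²)·(12·(2·(Λ_mβ/π + 3)·(2·(1793Λ_mL² + 704L)))·(βL²·1000/Λ_m²·fd))·(Np/(βL²)³))`, `Xv = U/(2^59·Psq²·Rsq²·β³)`, `Λ_m = klScale klE0 m = (4^m)⁻¹/32`.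
The consumer, k3c3-p1's «(B)-FIT» `…FlowReadResponseFit.frameResponse_hB_of_symbolSizes` (p596448), wants `≤ μc l·U²·4^{(l−2)(m+1)}` (`l ≤ 4`, `μc` scale-free).
This file is the arithmetic in between, for the steps `m + 1 ≤ n_β` of the (A)+(P) induction (KL STATUS (R111)), with the natural SCALE LAWS of the inputs:
the frame distance `fd ≤ Gfr₀·U·(16^m)⁻¹` (the history's `frameDist_klFlowFrameU_succ_le`), the tower input `Np ≤ cN·U·(4^m)ˡ`, the alias moments
`Nj ≤ cS·U·(4^m)ˡ`, `Nj′ ≤ 2·cE·U·(4^m)ˡ`, the graded far moments `Ns ≤ cSs·U`, `Ns′ ≤ 2·cEs·U` (β-free constants `cN, cS, cE, cSs, cEs ≥ 0`):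

* §1 ladder: `readExp_zpow_eq` (`4^{(l−2)(m+1)} = 4ˡ(4^m)ˡ/(16·(4^m)²)`), `fd_zpow_eq` (`4^{(0−2)m} = ((4^m)²)⁻¹`), `thirtytwo_mul_four_pow_le`
  (`m+1 ≤ n_β`, `klEngL₄ ≤ L ⇒ 32·4^m ≤ L`, i.e. `Λ_m·L ≥ 1`), `gfr0_abs_le_of_hdoor` (the envelope door `… ≤ 1/128 ⇒ Gfr₀|U| ≤ 1/128`),
  `fd_le_klScale_div_four` (`⇒ Gfr₀·uPow 0 U·4^{(0−2)m} ≤ Λ_m/4`, the door's `hfd`);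
* §2 `generalMain_eq` (the MAIN product `= 192000·(Λβ/π+3)·(1793ΛL²+704L)·fd·Np/(Λ²βL²)`), **`generalMain_le`**: for `π/β ≤ Λ_m/4` and `32·4^m ≤ L`,
  `MAIN ≤ (2^32/4ˡ·Gfr₀·cN)·(U²·4^{(l−2)(m+1)})` (`(Λβ/π+3) ≤ 7Λβ/(4π)`, `704L ≤ 704ΛL²`, `192000·7·2497/(4π) ≤ 2^28`; `fd·Np` carries exactly `U²`);
* §3 **`generalAlias_le`**: `ALIAS ≤ (Rsq⁴·(cS²+cE+1)/2^200)·(U²·4^{(l−2)(m+1)})` (`4^m ≤ β/8`, `β ≥ 2⁷`, `U ≤ 1`; true with `2^229` to spare);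
* §4 **`generalFar_le`**: `FAR ≤ ((cSs²+cEs+1)/2^200)·(U²·4^{(l−2)(m+1)})` (`Psq, Rsq ≥ 1`);
* §5 **`generalRHS_le_fit`**: the door's right-hand side `≤ X_l·(U²·4^{(l−2)(m+1)})`,
  `X_l = 2^32/4ˡ·Gfr₀·cN + (Rsq⁴·(cS²+cE+1) + (cSs²+cEs+1))/2^200`.

Pure real arithmetic on the tree's `klScale`/`nScales`/`klEngL₄`/`klEngRsq`/`klEngPsq`; no definitions; nothing about the model's sizes is asserted; nothing
asserts superconductivity.  References: BGM 2006 §2.3 (2.21)–(2.24), §2.4 (2.36) [cite: BenfattoGiulianiMastropietro2006].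
-/

noncomputable section

namespace Summit.HubbardSuperconductivity.HubbardSuperconductivity.Theorems.EngineV8

set_option linter.dupNamespace false -- summit = problem name (single-conjunct summit), D-0017
set_option exponentiation.threshold 1024 -- `2^218`, `2^233`, `2^236` literals

open Real Finset Summit.HubbardSuperconductivity.HubbardSuperconductivity.Theorems.KLRegimeSplit
open Summit.HubbardSuperconductivity.HubbardSuperconductivity.Theorems.KLProgrammeLegKernels
open scoped Nat

/-! ## §1 The ladder -/

/-- **The (B)-fit exponent on the ladder**: `4^{(l−2)(m+1)} = 4ˡ·(4^m)ˡ/(16·(4^m)²)`. [cite: BenfattoGiulianiMastropietro2006, §2.4 (2.36)] -/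
theorem readExp_zpow_eq (l m : ℕ) :
    (4 : ℝ) ^ (((l : ℤ) - 2) * ((m + 1 : ℕ) : ℤ)) = (4 : ℝ) ^ l * ((4 : ℝ) ^ m) ^ l / (16 * ((4 : ℝ) ^ m) ^ 2) := by
  have h4 : (4 : ℝ) ≠ 0 := by norm_num
  rw [show ((l : ℤ) - 2) * ((m + 1 : ℕ) : ℤ) = (((m + 1) * l : ℕ) : ℤ) - (((m + 1) * 2 : ℕ) : ℤ) by push_cast; ring,
    zpow_sub₀ h4, zpow_natCast, zpow_natCast, pow_mul, pow_mul, pow_succ, pow_succ, mul_pow, mul_pow]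
  ring

/-- **The frame-rate exponent**: `4^{(0−2)m} = ((4^m)²)⁻¹`. [cite: BenfattoGiulianiMastropietro2006, §2.4 (2.36)] -/
theorem fd_zpow_eq (m : ℕ) : (4 : ℝ) ^ ((((0 : ℕ) : ℤ) - 2) * (m : ℤ)) = (((4 : ℝ) ^ m) ^ 2)⁻¹ := by
  rw [show (((0 : ℕ) : ℤ) - 2) * (m : ℤ) = -((m * 2 : ℕ) : ℤ) by push_cast; ring, zpow_neg, zpow_natCast, pow_mul]

/-- **`Λ_m·L ≥ 1` at the registered volume**: `m + 1 ≤ n_β`, `klEngL₄ P R β U ≤ L ⇒ 32·4^m ≤ L`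
(`32·4^m ≤ 8·4^{n_β} ≤ β/(4π) ≤ β ≤ 2^{10}β²/U² ≤ klEngL₃ ≤ klEngL₄`). [cite: BenfattoGiulianiMastropietro2006, §2.3 (2.21)] -/
theorem thirtytwo_mul_four_pow_le {P : SplitConsts} {R : RenConsts} {β U : ℝ} (hβ : klBetaMin ≤ β) (hU : 0 < U) (hU1 : U ≤ 1)
    {m : ℕ} (hm : m + 1 ≤ nScales β) {L : ℕ} (hL : klEngL₄ P R β U ≤ L) : 32 * (4 : ℝ) ^ m ≤ (L : ℝ) := by
  have h128 : (128 : ℝ) ≤ β := by simpa [klBetaMin] using hβ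
  have h1 : (4 : ℝ) ^ (m + 1) ≤ (4 : ℝ) ^ nScales β := pow_le_pow_right₀ (by norm_num) hm
  have h2 := four_pow_nScales_le hβ
  rw [klE0] at h2
  have h3 : 1 / 32 * β / Real.pi ≤ β / 32 := by
    rw [div_le_div_iff₀ Real.pi_pos (by norm_num : (0:ℝ) < 32)]
    nlinarith [Real.pi_gt_three, h128]
  have hL3 : (klEngL₃ β U : ℝ) ≤ (L : ℝ) := by exact_mod_cast (klEngL₃_le_of_klEngL₄_le hL)
  have hsq := sq_div_sq_le_klEngL₃ (β := β) hU
  have hU2 : U ^ 2 ≤ 1 := by nlinarith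
  have hβ2 : 2 ^ 10 * β ^ 2 ≤ 2 ^ 10 * β ^ 2 / U ^ 2 := by
    rw [le_div_iff₀ (by positivity)]
    nlinarith [sq_nonneg β]
  have hLβ : β ≤ (L : ℝ) := by nlinarith
  rw [pow_succ] at h1
  nlinarith

/-- **`Gfr₀|U| ≤ 1/128` from the envelope door** `Gfr₀|U| + (Σ_{j<5} Gfr_j + π⁸W/2^{11})·U² ≤ 1/128` (`W ≥ 0`, `Gfr ≥ 0`).
[cite: BenfattoGiulianiMastropietro2006, §3 (3.2)] -/
theorem gfr0_abs_le_of_hdoor {R : RenConsts} (hR : ∀ j, 0 ≤ R.Gfr j) {W U : ℝ} (hW : 0 ≤ W)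
    (hdoor : R.Gfr 0 * |U| + ((∑ j ∈ range 5, R.Gfr j) + Real.pi ^ 8 * W / 2 ^ 11) * U ^ 2 ≤ 1 / 128) : R.Gfr 0 * |U| ≤ 1 / 128 := by
  have h1 : 0 ≤ ∑ j ∈ range 5, R.Gfr j := Finset.sum_nonneg fun j _ => hR j
  have h2 : 0 ≤ ((∑ j ∈ range 5, R.Gfr j) + Real.pi ^ 8 * W / 2 ^ 11) * U ^ 2 := by positivity
  linarith

/-- **The door's `hfd` for the history's frame rate**: `Gfr₀|U| ≤ 1/128 ⇒ Gfr₀·uPow 0 U·4^{(0−2)m} ≤ Λ_m/4` (`Λ_m/4 = (4^m)⁻¹/128`).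
[cite: BenfattoGiulianiMastropietro2006, §2.4 (2.36)] -/
theorem fd_le_klScale_div_four {R : RenConsts} (hR0 : 0 ≤ R.Gfr 0) {U : ℝ} (h : R.Gfr 0 * |U| ≤ 1 / 128) (m : ℕ) :
    R.Gfr 0 * uPow 0 U * (4 : ℝ) ^ ((((0 : ℕ) : ℤ) - 2) * (m : ℤ)) ≤ klScale klE0 m / 4 := by
  rw [uPow_zero, fd_zpow_eq]
  have hΛ : klScale klE0 m / 4 = 1 / 128 * ((4 : ℝ) ^ m)⁻¹ := by simp only [klScale, klE0]; ring
  rw [hΛ]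
  have hP1 : (1 : ℝ) ≤ (4 : ℝ) ^ m := one_le_pow₀ (by norm_num)
  have hP0 : (0 : ℝ) < (4 : ℝ) ^ m := by positivity
  have hinv : (((4 : ℝ) ^ m) ^ 2)⁻¹ ≤ ((4 : ℝ) ^ m)⁻¹ := by
    apply inv_anti₀ hP0
    nlinarith
  have h0 : 0 ≤ R.Gfr 0 * |U| := mul_nonneg hR0 (abs_nonneg U)
  calc R.Gfr 0 * |U| * (((4 : ℝ) ^ m) ^ 2)⁻¹ ≤ 1 / 128 * (((4 : ℝ) ^ m) ^ 2)⁻¹ := mul_le_mul_of_nonneg_right h (by positivity)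
    _ ≤ 1 / 128 * ((4 : ℝ) ^ m)⁻¹ := mul_le_mul_of_nonneg_left hinv (by norm_num)

/-! ## §2 The MAIN group (frame distance × tower input) -/

/-- **The MAIN product, collected**: for `0 < β`, `0 < L`, `0 < Λ`,
`2·(2·(|β|L²)·(12·(2·(Λβ/π+3)·(S+S))·(βL²·(200+200·4)/Λ²·fd))·(Np/(βL²)³)) = 192000·(Λβ/π+3)·S·fd·Np/(Λ²·β·L²)`, `S = 1793ΛL² + 704L`.
[cite: BenfattoGiulianiMastropietro2006, §2.3 (2.21)] -/
theorem generalMain_eq {β Lr Λ fd Np : ℝ} (hβ : 0 < β) (hL : 0 < Lr) (hΛ : 0 < Λ) :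
    2 * (2 * (|β| * Lr ^ 2) * (12 * (2 * (Λ * β / Real.pi + 3) * ((1793 * Λ * Lr ^ 2 + 704 * Lr) + (1793 * Λ * Lr ^ 2 + 704 * Lr)) *
      (β * Lr ^ 2 * (200 + 200 * 4) / Λ ^ 2 * fd)) * (Np / (β * Lr ^ 2) ^ 3))) =
      192000 * (Λ * β / Real.pi + 3) * (1793 * Λ * Lr ^ 2 + 704 * Lr) * fd * Np / (Λ ^ 2 * β * Lr ^ 2) := by
  rw [abs_of_pos hβ]
  field_simp
  ring

/-- `192000·7·2497/(4π) ≤ 2^28` (`π > 3.14`). -/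
theorem main_numeral_le : (838992000 : ℝ) / Real.pi ≤ 2 ^ 28 := by
  rw [div_le_iff₀ Real.pi_pos]
  nlinarith [Real.pi_gt_d2]

/-- **THE MAIN GROUP AGAINST THE (B)-FIT BUDGET**: for `π/β ≤ Λ_m/4` (`m + 1 ≤ n_β`), `32·4^m ≤ L`, the frame rate `fd ≤ Gfr₀·U·((4^m)²)⁻¹` and the tower law
`Np ≤ cN·U·(4^m)ˡ`, `MAIN ≤ (2^32/4ˡ·Gfr₀·cN)·(U²·4^{(l−2)(m+1)})`. [cite: BenfattoGiulianiMastropietro2006, §2.3 (2.21), §2.4 (2.36)] -/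
theorem generalMain_le {β fd Np Gfr0 cN U : ℝ} {L m l : ℕ} (hβ : 0 < β) (hπ : Real.pi / β ≤ klScale klE0 m / 4)
    (hL : 32 * (4 : ℝ) ^ m ≤ (L : ℝ)) (hfd0 : 0 ≤ fd) (hfd : fd ≤ Gfr0 * U * (((4 : ℝ) ^ m) ^ 2)⁻¹) (hNp0 : 0 ≤ Np)
    (hNp : Np ≤ cN * U * ((4 : ℝ) ^ m) ^ l) (hG : 0 ≤ Gfr0) (hU : 0 ≤ U) (hcN : 0 ≤ cN) :
    2 * (2 * (|β| * (L : ℝ) ^ 2) * (12 * (2 * ((klScale klE0 m) * β / Real.pi + 3) * ((1793 * (klScale klE0 m) * (L : ℝ) ^ 2 + 704 * L) +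
      (1793 * (klScale klE0 m) * (L : ℝ) ^ 2 + 704 * L)) * (β * (L : ℝ) ^ 2 * (200 + 200 * 4) / (klScale klE0 m) ^ 2 * fd)) * (Np / (β * (L : ℝ) ^ 2) ^ 3))) ≤
      2 ^ 32 / 4 ^ l * Gfr0 * cN * (U ^ 2 * (4 : ℝ) ^ (((l : ℤ) - 2) * ((m + 1 : ℕ) : ℤ))) := by
  set Λ := klScale klE0 m with hΛdef
  have hΛ : 0 < Λ := klth_klScale_pos m
  have hP : (0 : ℝ) < (4 : ℝ) ^ m := by positivity
  have hLpos : (0 : ℝ) < (L : ℝ) := lt_of_lt_of_le (by positivity) hL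
  have hπ0 := Real.pi_pos
  rw [generalMain_eq hβ hLpos hΛ]
  -- `(Λβ/π + 3) ≤ 7Λβ/(4π)` from `4π ≤ Λβ`
  have h4π : 4 * Real.pi ≤ Λ * β := by
    have h := (div_le_div_iff₀ hβ (by norm_num : (0:ℝ) < 4)).1 hπ
    linarith
  have hA0 : 0 ≤ Λ * β / Real.pi := by positivity
  have h1 : Λ * β / Real.pi + 3 ≤ 7 / 4 * (Λ * β / Real.pi) := by
    have h3 : 3 ≤ 3 / 4 * (Λ * β / Real.pi) := by
      rw [mul_div_assoc', le_div_iff₀ hπ0]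
      nlinarith
    linarith
  -- `S ≤ 2497ΛL²` from `ΛL ≥ 1`
  have hΛL : 1 ≤ Λ * (L : ℝ) := by
    have e : Λ * (L : ℝ) = (L : ℝ) / (32 * (4 : ℝ) ^ m) := by
      rw [hΛdef, klScale, klE0]; field_simp
    rw [e, le_div_iff₀ (by positivity)]
    linarith
  have h2 : 1793 * Λ * (L : ℝ) ^ 2 + 704 * (L : ℝ) ≤ 2497 * Λ * (L : ℝ) ^ 2 := by
    have : (L : ℝ) ≤ Λ * (L : ℝ) ^ 2 := by nlinarith
    nlinarith
  have hS0 : 0 ≤ 1793 * Λ * (L : ℝ) ^ 2 + 704 * (L : ℝ) := by positivity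
  -- `fd·Np`
  have hfN : fd * Np ≤ Gfr0 * cN * U ^ 2 * ((4 : ℝ) ^ m) ^ l * (((4 : ℝ) ^ m) ^ 2)⁻¹ := by
    calc fd * Np ≤ (Gfr0 * U * (((4 : ℝ) ^ m) ^ 2)⁻¹) * (cN * U * ((4 : ℝ) ^ m) ^ l) :=
          mul_le_mul hfd hNp hNp0 (by positivity)
      _ = Gfr0 * cN * U ^ 2 * ((4 : ℝ) ^ m) ^ l * (((4 : ℝ) ^ m) ^ 2)⁻¹ := by ring
  have hY0 : 0 ≤ Gfr0 * cN * U ^ 2 * ((4 : ℝ) ^ m) ^ l * (((4 : ℝ) ^ m) ^ 2)⁻¹ := by positivity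
  have hden : 0 < Λ ^ 2 * β * (L : ℝ) ^ 2 := by positivity
  have h4l : (4 : ℝ) ^ l ≠ 0 := by positivity
  calc 192000 * (Λ * β / Real.pi + 3) * (1793 * Λ * (L : ℝ) ^ 2 + 704 * (L : ℝ)) * fd * Np / (Λ ^ 2 * β * (L : ℝ) ^ 2)
      = (192000 * (Λ * β / Real.pi + 3) * (1793 * Λ * (L : ℝ) ^ 2 + 704 * (L : ℝ))) * (fd * Np) / (Λ ^ 2 * β * (L : ℝ) ^ 2) := by ring
    _ ≤ (192000 * (7 / 4 * (Λ * β / Real.pi)) * (2497 * Λ * (L : ℝ) ^ 2)) * (Gfr0 * cN * U ^ 2 * ((4 : ℝ) ^ m) ^ l * (((4 : ℝ) ^ m) ^ 2)⁻¹) /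
          (Λ ^ 2 * β * (L : ℝ) ^ 2) := by
        apply div_le_div_of_nonneg_right _ hden.le
        apply mul_le_mul _ hfN (mul_nonneg hfd0 hNp0) (by positivity)
        exact mul_le_mul (mul_le_mul_of_nonneg_left h1 (by norm_num)) h2 hS0 (by positivity)
    _ = (838992000 / Real.pi) * (Gfr0 * cN * U ^ 2 * ((4 : ℝ) ^ m) ^ l * (((4 : ℝ) ^ m) ^ 2)⁻¹) := by
        field_simp
        ring
    _ ≤ 2 ^ 28 * (Gfr0 * cN * U ^ 2 * ((4 : ℝ) ^ m) ^ l * (((4 : ℝ) ^ m) ^ 2)⁻¹) := mul_le_mul_of_nonneg_right main_numeral_le hY0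
    _ = 2 ^ 32 / 4 ^ l * Gfr0 * cN * (U ^ 2 * (4 : ℝ) ^ (((l : ℤ) - 2) * ((m + 1 : ℕ) : ℤ))) := by
        rw [readExp_zpow_eq]
        field_simp
        ring

/-! ## §3 The ALIAS group -/

/-- `√Rsq⁸ = Rsq⁴`. -/
theorem sqrt_klEngRsq_pow_eight (R : RenConsts) : Real.sqrt (klEngRsq R) ^ 8 = klEngRsq R ^ 4 := by
  rw [show (8 : ℕ) = 2 * 4 from rfl, pow_mul, Real.sq_sqrt (klEngRsq_pos R).le]

/-- **The scale ladder against the alias currency**: `m ≤ n_β + 1 ⇒ 2^233·(4^m)^13 ≤ 2^218·β^14` (`4^m ≤ β/8`, `1 ≤ β`).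
[cite: BenfattoGiulianiMastropietro2006, §2.3 (2.21)] -/
theorem alias_ladder_le {β : ℝ} (hβ : klBetaMin ≤ β) {m : ℕ} (hm : m ≤ nScales β + 1) :
    2 ^ 233 * ((4 : ℝ) ^ m) ^ 13 ≤ 2 ^ 218 * β ^ 14 := by
  have h128 : (128 : ℝ) ≤ β := by simpa [klBetaMin] using hβ
  have hP8 := four_pow_le_beta_div_eight hβ hm
  have hP0 : (0 : ℝ) ≤ (4 : ℝ) ^ m := by positivity
  have h13 : ((4 : ℝ) ^ m) ^ 13 ≤ (β / 8) ^ 13 := pow_le_pow_left₀ hP0 hP8 13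
  have hβ13 : 0 ≤ β ^ 13 := by positivity
  have hβ14 : β ^ 13 ≤ β ^ 14 := by
    rw [pow_succ]
    exact le_mul_of_one_le_right hβ13 (by linarith)
  calc 2 ^ 233 * ((4 : ℝ) ^ m) ^ 13 ≤ 2 ^ 233 * (β / 8) ^ 13 := by gcongr
    _ = 2 ^ 194 * β ^ 13 := by rw [div_pow]; norm_num; ring
    _ ≤ 2 ^ 194 * β ^ 14 := by gcongr
    _ ≤ 2 ^ 218 * β ^ 14 := by gcongr <;> norm_num

/-- **THE ALIAS GROUP AGAINST THE (B)-FIT BUDGET**: with `Nj ≤ cS·U·(4^m)ˡ`, `Nj′ ≤ 2·cE·U·(4^m)ˡ` (`l ≤ 4`, `0 ≤ U ≤ 1`, `m ≤ n_β + 1`),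
`(2^29·4^m·Nj² + 2^12 + 2^23·Nj′)·(√Rsq⁸U³⁰/(2^218β^14)) ≤ (Rsq⁴·(cS²+cE+1)/2^200)·(U²·4^{(l−2)(m+1)})`. [cite: BenfattoGiulianiMastropietro2006, §2.3 (2.24)] -/
theorem generalAlias_le (R : RenConsts) {β U Nj Nj' cS cE : ℝ} {m l : ℕ} (hβ : klBetaMin ≤ β) (hm : m ≤ nScales β + 1)
    (hU : 0 ≤ U) (hU1 : U ≤ 1) (hl : l ≤ 4) (hNj0 : 0 ≤ Nj) (hNj : Nj ≤ cS * U * ((4 : ℝ) ^ m) ^ l)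
    (hNj' : Nj' ≤ 2 * (cE * U * ((4 : ℝ) ^ m) ^ l)) (hcS : 0 ≤ cS) (hcE : 0 ≤ cE) :
    (2 ^ 29 * (4 : ℝ) ^ m * Nj ^ 2 + 2 ^ 12 + 2 ^ 23 * Nj') * (Real.sqrt (klEngRsq R) ^ 8 * U ^ 30 / (2 ^ 218 * β ^ 14)) ≤
      klEngRsq R ^ 4 * (cS ^ 2 + cE + 1) / 2 ^ 200 * (U ^ 2 * (4 : ℝ) ^ (((l : ℤ) - 2) * ((m + 1 : ℕ) : ℤ))) := by
  have hβ0 : 0 < β := pos_of_klBetaMin_le hβ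
  set P : ℝ := (4 : ℝ) ^ m with hPdef
  have hP1 : 1 ≤ P := one_le_pow₀ (by norm_num)
  have hP0 : 0 < P := by positivity
  have hRsq := klEngRsq_pos R
  rw [sqrt_klEngRsq_pow_eight, readExp_zpow_eq]
  -- the bracket `≤ 2^29·(cS²+cE+1)·P^11`
  have hPl : P ^ l ≤ P ^ 11 := pow_le_pow_right₀ hP1 (by omega)
  have hP2l : P * (P ^ l) ^ 2 ≤ P ^ 11 := by
    rw [← pow_mul, ← pow_succ']
    exact pow_le_pow_right₀ hP1 (by omega)
  have hNjU : Nj ≤ cS * P ^ l := by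
    calc Nj ≤ cS * U * P ^ l := hNj
      _ ≤ cS * 1 * P ^ l := by gcongr
      _ = cS * P ^ l := by ring
  have hNj2 : Nj ^ 2 ≤ cS ^ 2 * (P ^ l) ^ 2 := by
    rw [← mul_pow]; exact pow_le_pow_left₀ hNj0 hNjU 2
  have hNj'U : Nj' ≤ 2 * cE * P ^ l := by
    calc Nj' ≤ 2 * (cE * U * P ^ l) := hNj'
      _ ≤ 2 * (cE * 1 * P ^ l) := by gcongr
      _ = 2 * cE * P ^ l := by ring
  have hbr : 2 ^ 29 * P * Nj ^ 2 + 2 ^ 12 + 2 ^ 23 * Nj' ≤ 2 ^ 29 * (cS ^ 2 + cE + 1) * P ^ 11 := by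
    have e1 : 2 ^ 29 * P * Nj ^ 2 ≤ 2 ^ 29 * cS ^ 2 * P ^ 11 := by
      calc 2 ^ 29 * P * Nj ^ 2 ≤ 2 ^ 29 * P * (cS ^ 2 * (P ^ l) ^ 2) := by gcongr
        _ = 2 ^ 29 * cS ^ 2 * (P * (P ^ l) ^ 2) := by ring
        _ ≤ 2 ^ 29 * cS ^ 2 * P ^ 11 := by gcongr
    have e2 : (2 : ℝ) ^ 12 ≤ 2 ^ 29 * P ^ 11 := by
      have : (1 : ℝ) ≤ P ^ 11 := one_le_pow₀ hP1
      nlinarith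
    have e3 : 2 ^ 23 * Nj' ≤ 2 ^ 29 * cE * P ^ 11 := by
      calc 2 ^ 23 * Nj' ≤ 2 ^ 23 * (2 * cE * P ^ l) := by gcongr
        _ = 2 ^ 24 * cE * P ^ l := by ring
        _ ≤ 2 ^ 24 * cE * P ^ 11 := by gcongr
        _ ≤ 2 ^ 29 * cE * P ^ 11 := by gcongr <;> norm_num
    nlinarith
  -- `U^30 ≤ U²`
  have hU30 : U ^ 30 ≤ U ^ 2 := pow_le_pow_of_le_one hU hU1 (by norm_num)
  have hlad := alias_ladder_le hβ hm
  -- the ladder: `2^29·P^11/(2^218β^14) ≤ 1/(2^204·P²)`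
  have hkey : 2 ^ 29 * P ^ 11 / (2 ^ 218 * β ^ 14) ≤ 1 / (2 ^ 200 * (16 * P ^ 2)) := by
    rw [div_le_div_iff₀ (by positivity) (by positivity)]
    have e : 2 ^ 29 * P ^ 11 * (2 ^ 200 * (16 * P ^ 2)) = 2 ^ 233 * P ^ 13 := by ring
    rw [e, one_mul]
    exact hlad
  have hC0 : 0 ≤ klEngRsq R ^ 4 * (cS ^ 2 + cE + 1) := by positivity
  calc (2 ^ 29 * P * Nj ^ 2 + 2 ^ 12 + 2 ^ 23 * Nj') * (klEngRsq R ^ 4 * U ^ 30 / (2 ^ 218 * β ^ 14))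
      ≤ (2 ^ 29 * (cS ^ 2 + cE + 1) * P ^ 11) * (klEngRsq R ^ 4 * U ^ 2 / (2 ^ 218 * β ^ 14)) := by
        apply mul_le_mul hbr _ (by positivity) (by positivity)
        gcongr
    _ = klEngRsq R ^ 4 * (cS ^ 2 + cE + 1) * U ^ 2 * (2 ^ 29 * P ^ 11 / (2 ^ 218 * β ^ 14)) := by ring
    _ ≤ klEngRsq R ^ 4 * (cS ^ 2 + cE + 1) * U ^ 2 * (1 / (2 ^ 200 * (16 * P ^ 2))) :=
        mul_le_mul_of_nonneg_left hkey (by positivity)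
    _ = klEngRsq R ^ 4 * (cS ^ 2 + cE + 1) / 2 ^ 200 * (U ^ 2 * (1 / (16 * P ^ 2))) := by ring
    _ ≤ klEngRsq R ^ 4 * (cS ^ 2 + cE + 1) / 2 ^ 200 * (U ^ 2 * ((4 : ℝ) ^ l * P ^ l / (16 * P ^ 2))) := by
        apply mul_le_mul_of_nonneg_left _ (by positivity)
        apply mul_le_mul_of_nonneg_left _ (by positivity)
        apply div_le_div_of_nonneg_right _ (by positivity)
        exact one_le_mul_of_one_le_of_one_le (one_le_pow₀ (by norm_num)) (one_le_pow₀ hP1)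

/-! ## §4 The FAR group -/

/-- **THE FAR GROUP AGAINST THE (B)-FIT BUDGET**: with the graded far envelopes read as `Ns ≤ cSs·U`, `Ns′ ≤ 2·cEs·U` (`0 ≤ U ≤ 1`, `m ≤ n_β + 1`),
`(2^26·4^m·Ns² + 2^9 + 2^20·Ns′)·Xv⁴ ≤ ((cSs²+cEs+1)/2^200)·(U²·4^{(l−2)(m+1)})`, `Xv = U/(2^59·Psq²·Rsq²·β³)`. [cite: BenfattoGiulianiMastropietro2006, §2.3 (2.24)] -/
theorem generalFar_le (P : SplitConsts) (R : RenConsts) {β U Ns Ns' cSs cEs : ℝ} {m l : ℕ} (hβ : klBetaMin ≤ β) (hm : m ≤ nScales β + 1)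
    (hU : 0 ≤ U) (hU1 : U ≤ 1) (hNs0 : 0 ≤ Ns) (hNs : Ns ≤ cSs * U) (hNs' : Ns' ≤ 2 * (cEs * U)) (hcSs : 0 ≤ cSs) (hcEs : 0 ≤ cEs) :
    (2 ^ 26 * (4 : ℝ) ^ m * Ns ^ 2 + 2 ^ 9 + 2 ^ 20 * Ns') * (U / (2 ^ 59 * klEngPsq P ^ 2 * klEngRsq R ^ 2 * β ^ 3)) ^ 4 ≤
      (cSs ^ 2 + cEs + 1) / 2 ^ 200 * (U ^ 2 * (4 : ℝ) ^ (((l : ℤ) - 2) * ((m + 1 : ℕ) : ℤ))) := by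
  have hβ0 : 0 < β := pos_of_klBetaMin_le hβ
  have h128 : (128 : ℝ) ≤ β := by simpa [klBetaMin] using hβ
  set Pm : ℝ := (4 : ℝ) ^ m with hPdef
  have hP1 : 1 ≤ Pm := one_le_pow₀ (by norm_num)
  have hP0 : 0 < Pm := by positivity
  have hP8 : Pm ≤ β / 8 := four_pow_le_beta_div_eight hβ hm
  rw [readExp_zpow_eq]
  -- `Xv⁴ ≤ U²/(2^236·β^12)`
  have hXv := xv_le_inv_cube P R hU1 hβ0
  have hXv0 : 0 ≤ U / (2 ^ 59 * klEngPsq P ^ 2 * klEngRsq R ^ 2 * β ^ 3) :=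
    div_nonneg hU (by have := klEngPsq_pos P; have := klEngRsq_pos R; positivity)
  have hXvU : U / (2 ^ 59 * klEngPsq P ^ 2 * klEngRsq R ^ 2 * β ^ 3) ≤ U / (2 ^ 59 * β ^ 3) := by
    apply div_le_div_of_nonneg_left hU (by positivity)
    have hPR : 1 ≤ klEngPsq P ^ 2 * klEngRsq R ^ 2 :=
      one_le_mul_of_one_le_of_one_le (one_le_pow₀ (one_le_klEngPsq P)) (one_le_pow₀ (one_le_klEngRsq R))
    nlinarith [pow_pos hβ0 3]
  have hX4 : (U / (2 ^ 59 * klEngPsq P ^ 2 * klEngRsq R ^ 2 * β ^ 3)) ^ 4 ≤ U ^ 2 / (2 ^ 236 * β ^ 12) := by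
    calc (U / (2 ^ 59 * klEngPsq P ^ 2 * klEngRsq R ^ 2 * β ^ 3)) ^ 4 ≤ (U / (2 ^ 59 * β ^ 3)) ^ 4 := pow_le_pow_left₀ hXv0 hXvU 4
      _ = U ^ 4 / (2 ^ 236 * β ^ 12) := by rw [div_pow]; ring
      _ ≤ U ^ 2 / (2 ^ 236 * β ^ 12) := by
          apply div_le_div_of_nonneg_right _ (by positivity)
          exact pow_le_pow_of_le_one hU hU1 (by norm_num)
  -- the bracket `≤ 2^26·(cSs²+cEs+1)·Pm`
  have hNsU : Ns ≤ cSs := by nlinarith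
  have hNs2 : Ns ^ 2 ≤ cSs ^ 2 := pow_le_pow_left₀ hNs0 hNsU 2
  have hNs'U : Ns' ≤ 2 * cEs := by nlinarith
  have hbr : 2 ^ 26 * Pm * Ns ^ 2 + 2 ^ 9 + 2 ^ 20 * Ns' ≤ 2 ^ 26 * (cSs ^ 2 + cEs + 1) * Pm := by
    have e1 : 2 ^ 26 * Pm * Ns ^ 2 ≤ 2 ^ 26 * Pm * cSs ^ 2 := by gcongr
    have e3 : 2 ^ 20 * Ns' ≤ 2 ^ 26 * cEs * Pm := by nlinarith
    nlinarith
  -- the ladder: `2^26·Pm/(2^236β^12) ≤ 1/(2^204·Pm²)` iff `2^230·Pm³ ≤ 2^236·β^12`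
  have hlad : 2 ^ 26 * Pm * (2 ^ 200 * (16 * Pm ^ 2)) ≤ 1 * (2 ^ 236 * β ^ 12) := by
    have h3 : Pm ^ 3 ≤ (β / 8) ^ 3 := pow_le_pow_left₀ hP0.le hP8 3
    have hβ3 : 0 ≤ β ^ 3 := by positivity
    have hβ9 : (1 : ℝ) ≤ β ^ 9 := one_le_pow₀ (by linarith)
    have e : (β / 8) ^ 3 = β ^ 3 / 512 := by rw [div_pow]; norm_num
    rw [e] at h3
    have : Pm ^ 3 ≤ β ^ 12 := by
      calc Pm ^ 3 ≤ β ^ 3 / 512 := h3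
        _ ≤ β ^ 3 := by linarith
        _ ≤ β ^ 3 * β ^ 9 := le_mul_of_one_le_right hβ3 hβ9
        _ = β ^ 12 := by ring
    nlinarith
  have hkey : 2 ^ 26 * Pm / (2 ^ 236 * β ^ 12) ≤ 1 / (2 ^ 200 * (16 * Pm ^ 2)) := by
    rw [div_le_div_iff₀ (by positivity) (by positivity)]
    exact hlad
  have hC0 : 0 ≤ cSs ^ 2 + cEs + 1 := by positivity
  calc (2 ^ 26 * Pm * Ns ^ 2 + 2 ^ 9 + 2 ^ 20 * Ns') * (U / (2 ^ 59 * klEngPsq P ^ 2 * klEngRsq R ^ 2 * β ^ 3)) ^ 4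
      ≤ (2 ^ 26 * (cSs ^ 2 + cEs + 1) * Pm) * (U ^ 2 / (2 ^ 236 * β ^ 12)) :=
        mul_le_mul hbr hX4 (pow_nonneg hXv0 4) (by positivity)
    _ = (cSs ^ 2 + cEs + 1) * U ^ 2 * (2 ^ 26 * Pm / (2 ^ 236 * β ^ 12)) := by ring
    _ ≤ (cSs ^ 2 + cEs + 1) * U ^ 2 * (1 / (2 ^ 200 * (16 * Pm ^ 2))) := mul_le_mul_of_nonneg_left hkey (by positivity)
    _ = (cSs ^ 2 + cEs + 1) / 2 ^ 200 * (U ^ 2 * (1 / (16 * Pm ^ 2))) := by ring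
    _ ≤ (cSs ^ 2 + cEs + 1) / 2 ^ 200 * (U ^ 2 * ((4 : ℝ) ^ l * Pm ^ l / (16 * Pm ^ 2))) := by
        apply mul_le_mul_of_nonneg_left _ (by positivity)
        apply mul_le_mul_of_nonneg_left _ (by positivity)
        apply div_le_div_of_nonneg_right _ (by positivity)
        exact one_le_mul_of_one_le_of_one_le (one_le_pow₀ (by norm_num)) (one_le_pow₀ hP1)

/-! ## §5 The door's right-hand side against the budget -/

/-- **THE GENERAL-STEP (B) DOOR'S RIGHT-HAND SIDE AGAINST THE (B)-FIT BUDGET** (the arithmetic word): under the scale laws of the module docstring,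
for `m + 1 ≤ n_β`, `klEngL₄ ≤ L`, `l ≤ 4`,
`MAIN + ALIAS + FAR ≤ (2^32/4ˡ·Gfr₀·cN + (Rsq⁴·(cS²+cE+1) + (cSs²+cEs+1))/2^200)·(U²·4^{(l−2)(m+1)})`.
[cite: BenfattoGiulianiMastropietro2006, §2.3 (2.21)–(2.24), §2.4 (2.36)] -/
theorem generalRHS_le_fit (P : SplitConsts) (R : RenConsts) {β U fd Np Nj Nj' Ns Ns' cN cS cE cSs cEs : ℝ} {L m l : ℕ}
    (hβ : klBetaMin ≤ β) (hm : m + 1 ≤ nScales β) (hU : 0 < U) (hU1 : U ≤ 1) (hL : klEngL₄ P R β U ≤ L) (hl : l ≤ 4)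
    (hfd0 : 0 ≤ fd) (hfd : fd ≤ R.Gfr 0 * U * (((4 : ℝ) ^ m) ^ 2)⁻¹) (hG : 0 ≤ R.Gfr 0)
    (hNp0 : 0 ≤ Np) (hNp : Np ≤ cN * U * ((4 : ℝ) ^ m) ^ l)
    (hNj0 : 0 ≤ Nj) (hNj : Nj ≤ cS * U * ((4 : ℝ) ^ m) ^ l) (hNj' : Nj' ≤ 2 * (cE * U * ((4 : ℝ) ^ m) ^ l))
    (hNs0 : 0 ≤ Ns) (hNs : Ns ≤ cSs * U) (hNs' : Ns' ≤ 2 * (cEs * U))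
    (hcN : 0 ≤ cN) (hcS : 0 ≤ cS) (hcE : 0 ≤ cE) (hcSs : 0 ≤ cSs) (hcEs : 0 ≤ cEs) :
    2 * (2 * (|β| * (L : ℝ) ^ 2) * (12 * (2 * ((klScale klE0 m) * β / Real.pi + 3) * ((1793 * (klScale klE0 m) * (L : ℝ) ^ 2 + 704 * L) +
      (1793 * (klScale klE0 m) * (L : ℝ) ^ 2 + 704 * L)) * (β * (L : ℝ) ^ 2 * (200 + 200 * 4) / (klScale klE0 m) ^ 2 * fd)) * (Np / (β * (L : ℝ) ^ 2) ^ 3))) +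
      ((2 ^ 29 * (4 : ℝ) ^ m * Nj ^ 2 + 2 ^ 12 + 2 ^ 23 * Nj') * (Real.sqrt (klEngRsq R) ^ 8 * U ^ 30 / (2 ^ 218 * β ^ 14)) +
        (2 ^ 26 * (4 : ℝ) ^ m * Ns ^ 2 + 2 ^ 9 + 2 ^ 20 * Ns') * (U / (2 ^ 59 * klEngPsq P ^ 2 * klEngRsq R ^ 2 * β ^ 3)) ^ 4) ≤
      (2 ^ 32 / 4 ^ l * R.Gfr 0 * cN + (klEngRsq R ^ 4 * (cS ^ 2 + cE + 1) + (cSs ^ 2 + cEs + 1)) / 2 ^ 200) *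
        (U ^ 2 * (4 : ℝ) ^ (((l : ℤ) - 2) * ((m + 1 : ℕ) : ℤ))) := by
  have hβ0 : 0 < β := pos_of_klBetaMin_le hβ
  have hmβ : m ≤ nScales β + 1 := by omega
  have h1 := generalMain_le (l := l) hβ0 (pi_div_le_klScale_div_four_of_succ_le_nScales hβ hm) (thirtytwo_mul_four_pow_le hβ hU hU1 hm hL)
    hfd0 hfd hNp0 hNp hG hU.le hcN
  have h2 := generalAlias_le R (l := l) hβ hmβ hU.le hU1 hl hNj0 hNj hNj' hcS hcE
  have h3 := generalFar_le P R (l := l) hβ hmβ hU.le hU1 hNs0 hNs hNs' hcSs hcEs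
  calc _ ≤ 2 ^ 32 / 4 ^ l * R.Gfr 0 * cN * (U ^ 2 * (4 : ℝ) ^ (((l : ℤ) - 2) * ((m + 1 : ℕ) : ℤ))) +
        (klEngRsq R ^ 4 * (cS ^ 2 + cE + 1) / 2 ^ 200 * (U ^ 2 * (4 : ℝ) ^ (((l : ℤ) - 2) * ((m + 1 : ℕ) : ℤ))) +
          (cSs ^ 2 + cEs + 1) / 2 ^ 200 * (U ^ 2 * (4 : ℝ) ^ (((l : ℤ) - 2) * ((m + 1 : ℕ) : ℤ)))) := add_le_add h1 (add_le_add h2 h3)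
    _ = _ := by ring

end Summit.HubbardSuperconductivity.HubbardSuperconductivity.Theorems.EngineV8

end
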